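import Summits.NavierStokesRegularity.OSWSelfSimilar.SheetREvenResolventIdentity
import Summits.NavierStokesRegularity.OSWSelfSimilar.SheetREvenClass
import Literature.Analysis.OperatorTheory.PseudoResolventOperator
import HarnessLib

/-!
# SHEET-ℝ frame, EVEN ZERO-MASS class `E⁺₀` — dictionary layer 8: on the EVEN ZERO-MASS CLASS the resolvent `R⁺_K(σ)` is an INJECTIVE
# pseudo-resolvent, hence THE resolvent of a CLOSED operator `T⁺ = −A⁺_F|_{E⁺₀}` — the KERNEL CAVEAT of `SheetREvenResolvent` discharged

HONEST FRAMING (cell ns-blowup GROUP B / zone Z3, case Z3-SR-SPEC EVEN half, HYPOTHESIS-LEDGER row (P5)⁺ «no even resolvent dictionary»;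
1-D MODEL certificate frame (viscous gCLM/OSW sheet on the line); not Euler/NS; «violates: none — MODEL»).  Nothing here asserts that a profile
exists; the (S1⁺) datum `GardingDataKE` is the HYPOTHESIS; `K : EspE L hL →L[ℝ] W L` is an arbitrary bounded real operator.
Twin of `SheetRResolventOddClass`:

* `resolventKE_mem_WcevenZ` — `R⁺_K(σ)` takes values in `WcevenZ`; `resolventEven hL K h σ : WcevenZ hL →L[ℂ] WcevenZ hL` (restriction);
  `isPseudoResolvent_resolventEven`, `differentiableOn_resolventEven`, `norm_resolventEven_le_inv` (`‖R⁺(σ)G‖ ≤ ‖G‖/(m + Re σ)`);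
* `eq_zero_of_ιEE_eq_zero` — the pivot embedding of `EspE` is injective; **`injective_resolventEven`** (density lemma
  `SheetREvenClass.eq_zero_of_mem_WcevenZ`);
* **`generatorEven hL K h σ₀ hσ₀ := operatorOfResolvent (resolventEven hL K h) σ₀ _`** — Kato's CLOSED operator `T⁺` with `R⁺_K(σ) = (σ − T⁺)⁻¹`
  for every `σ` in the half-plane (`isClosed_generatorEven`, `generatorEven_resolventEven`, `resolventEven_generatorEven`,
  `eigen_generatorEven_iff`): the object the resolvent-keyed sentences of `PseudoResolventRankOneEigenvalue` and the even assembly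
  `SheetRSpectrumEvenPointAssembly` (J := resolventEven) are stated on.
Two definitions (`resolventEven`, `generatorEven`); no named fact.  WHAT THIS IS NOT: not NS; not the spectral certificate; no number of record moves.
-/

noncomputable section

namespace Summit.NavierStokesRegularity.OSWSelfSimilar
namespace SheetRResolventEvenClass

open _root_.MeasureTheory _root_.Set _root_.Filter _root_.Real SheetRWeakProfilePV SheetRWeakToStrong SheetREnergyClass SheetRWeightedMeasure
  SheetRLinearisedTests SheetREnergySpace SheetRTestSpace SheetRLinearisedFormBounds SheetREvenTests SheetREvenEnergySpace SheetREvenForms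
  SheetREvenPairOperator SheetREvenPairUniqueness SheetREvenResolvent SheetREvenResolventIdentity SheetREvenClass SheetRComplexPivot
  SheetROddClass SheetRResolventIdentity SheetRLinearisedCutoffEnergy Literature.Analysis.OperatorTheory
open scoped Topology ENNReal

variable {L D₀ D₁ V₀ c m : ℝ} {d V : ℝ → ℝ}

/-! ### §1 The resolvent takes values in the even zero-mass class; restriction -/

/-- `R⁺_K(σ)G ∈ WcevenZ` for every `G`. [folklore] -/
theorem resolventKE_mem_WcevenZ (hL : 0 < L) (K : EspE L hL →L[ℝ] W L) (h : GardingDataKE L hL d V K D₀ D₁ V₀ c m) (σ : ℂ) (G : Wc L) :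
    resolventKE hL K h σ G ∈ WcevenZ hL := by
  by_cases hσ : -m < σ.re
  · obtain ⟨happ, -, -, -⟩ := resolventKE_weak hL K h hσ G
    rw [happ]
    exact ofPair_ιpairE_mem_WcevenZ hL _
  · rw [resolventKE_of_not hL K h hσ]
    exact (WcevenZ hL).zero_mem

/-- **The resolvent on the even zero-mass class**: restriction–corestriction of `R⁺_K(σ)`. [folklore] -/
def resolventEven (hL : 0 < L) (K : EspE L hL →L[ℝ] W L) (h : GardingDataKE L hL d V K D₀ D₁ V₀ c m) (σ : ℂ) :
    WcevenZ hL →L[ℂ] WcevenZ hL :=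
  ((resolventKE hL K h σ).comp (WcevenZ hL).subtypeL).codRestrict (WcevenZ hL) fun G => resolventKE_mem_WcevenZ hL K h σ (G : Wc L)

/-- `resolventEven σ G = R⁺_K(σ) G` as elements of `L²_w(ℂ)`. [folklore] -/
theorem coe_resolventEven (hL : 0 < L) (K : EspE L hL →L[ℝ] W L) (h : GardingDataKE L hL d V K D₀ D₁ V₀ c m) (σ : ℂ) (G : WcevenZ hL) :
    ((resolventEven hL K h σ G : WcevenZ hL) : Wc L) = resolventKE hL K h σ (G : Wc L) := rfl

/-- **Pseudo-resolvent on the even zero-mass class**. [folklore] -/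
theorem isPseudoResolvent_resolventEven (hL : 0 < L) (K : EspE L hL →L[ℝ] W L) (h : GardingDataKE L hL d V K D₀ D₁ V₀ c m) :
    IsPseudoResolvent {σ : ℂ | -m < σ.re} (resolventEven hL K h) := by
  intro z hz w hw
  refine ContinuousLinearMap.ext fun G => Subtype.ext ?_
  show (((resolventEven hL K h z G - resolventEven hL K h w G : WcevenZ hL)) : Wc L) =
    ((((w - z) • resolventEven hL K h z (resolventEven hL K h w G)) : WcevenZ hL) : Wc L)
  rw [Submodule.coe_sub, Submodule.coe_smul, coe_resolventEven, coe_resolventEven, coe_resolventEven, coe_resolventEven]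
  exact resolventKE_sub hL K h hz hw (G : Wc L)

/-- Holomorphy of `σ ↦ resolventEven σ` on the half-plane. [folklore] -/
theorem differentiableOn_resolventEven (hL : 0 < L) (K : EspE L hL →L[ℝ] W L) (h : GardingDataKE L hL d V K D₀ D₁ V₀ c m) :
    DifferentiableOn ℂ (resolventEven hL K h) {σ : ℂ | -m < σ.re} := by
  haveI : CompleteSpace (WcevenZ hL) := completeSpace_WcevenZ hL
  exact IsPseudoResolvent.differentiableOn (A := WcevenZ hL →L[ℂ] WcevenZ hL) (isPseudoResolvent_resolventEven hL K h) (isOpen_halfPlane m)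

/-- The sharp pivot bound restricts: `‖resolventEven σ G‖ ≤ ‖G‖/(m + Re σ)`. [folklore] -/
theorem norm_resolventEven_le_inv (hL : 0 < L) (K : EspE L hL →L[ℝ] W L) (h : GardingDataKE L hL d V K D₀ D₁ V₀ c m) {σ : ℂ}
    (hσ : -m < σ.re) (G : WcevenZ hL) : ‖resolventEven hL K h σ G‖ ≤ ‖G‖ / (m + σ.re) :=
  norm_resolventKE_le_inv hL K h hσ (G : Wc L)

/-! ### §2 Injectivity on the even zero-mass class -/

/-- The pivot embedding `ιEE` is injective: `ιEE p = 0 ⇒ p = 0`. [folklore] -/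
theorem eq_zero_of_ιEE_eq_zero (hL : 0 < L) {p : EspE L hL} (hp : ιEE hL p = 0) : p = 0 := by
  obtain ⟨hu', -, hu₁m', h0, h1', -, e1, -⟩ := energyClassE_of_mem hL p
  have hu : ∀ x, profile p x = profile p 0 + ∫ s in (0 : ℝ)..x, derE p s := hu'
  have hu₁m : AEStronglyMeasurable (derE p) volume := hu₁m'
  have h1 : Integrable fun y => (L ^ 2 + y ^ 2) * derE p y ^ 2 := h1'
  obtain ⟨huc, -, -, -, -⟩ := basic_of_primitive hL hu hu₁m h0 h1
  obtain ⟨-, -, hsq⟩ := norm_ιEE hL p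
  have hI : (∫ ξ, (L ^ 2 + ξ ^ 2) * profile p ξ ^ 2) = 0 := by rw [← hsq, hp, norm_zero]; ring
  have hz := eq_zero_of_weightedSq_eq_zero hL huc h0 hI
  -- `profile p ≡ 0` ⇒ `baseConst p = 0` and `prim (derE p) ≡ 0` ⇒ `derE p = 0` a.e.
  have hb : baseConst p = 0 := by rw [← profile_zero p]; exact hz 0
  have hprim : ∀ x, prim (derE p) x = 0 := fun x => by
    have := hz x; rw [profile_eq, hb, zero_add] at this; exact this
  have hfloc : LocallyIntegrable (derE p) volume :=
    (memLp_two_of_weighted_sq hL hu₁m h1).locallyIntegrable one_le_two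
  have hsnd_ae : derE p =ᵐ[volume] 0 := by
    filter_upwards [_root_.LocallyIntegrable.ae_hasDerivAt_integral hfloc] with y hy
    have hy0 := hy 0
    have hF : (fun x => ∫ t in (0 : ℝ)..x, derE p t) = fun _ => (0 : ℝ) := funext hprim
    rw [hF] at hy0
    exact hy0.unique (hasDerivAt_const y (0 : ℝ))
  have hμ : μw L ≪ volume := by rw [μw_eq]; exact withDensity_absolutelyContinuous _ _
  have hsnd : ((p : WithLp 2 (W L × W L)).snd : W L) = 0 :=
    Lp.eq_zero_iff_ae_eq_zero.2 (hμ.ae_le hsnd_ae)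
  have hfst : ((p : WithLp 2 (W L × W L)).fst : W L) = 0 := by
    have h2 := ιEE_apply hL p
    rw [hp] at h2
    have : (2 : ℝ) • ((p : WithLp 2 (W L × W L)).fst : W L) = 0 := h2.symm
    rcases smul_eq_zero.1 this with h3 | h3
    · norm_num at h3
    · exact h3
  have hfst' : ((p : WithLp 2 (W L × W L)).fst : W L) = (((0 : EspE L hL) : WithLp 2 (W L × W L)).fst : W L) := by
    rw [hfst, Submodule.coe_zero, WithLp.zero_fst]
  have hsnd' : ((p : WithLp 2 (W L × W L)).snd : W L) = (((0 : EspE L hL) : WithLp 2 (W L × W L)).snd : W L) := by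
    rw [hsnd, Submodule.coe_zero, WithLp.zero_snd]
  exact Subtype.ext (WithLp.ofLp_injective 2 (Prod.ext hfst' hsnd'))

/-- The left-hand sides of the pair system at the zero pair vanish. [folklore] -/
theorem lhs_zeroE (hL : 0 < L) (K : EspE L hL →L[ℝ] W L) (h : GardingDataKE L hL d V K D₀ D₁ V₀ c m) (s t : ℝ) (v v₁ : ℝ → ℝ)
    (hv : IsCompactTestE v v₁) (h0 : ∫ y, v y = 0) :
    linForm L d (fun ξ => V ξ + s) (profile (0 : EspE L hL)) (derE (0 : EspE L hL)) v v₁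
        + (∫ y, (L ^ 2 + y ^ 2) * (((K (0 : EspE L hL) : W L) : ℝ → ℝ) y * v y))
        - t * ∫ y, (L ^ 2 + y ^ 2) * (profile (0 : EspE L hL) y * v y) = 0 ∧
      linForm L d (fun ξ => V ξ + s) (profile (0 : EspE L hL)) (derE (0 : EspE L hL)) v v₁
        + (∫ y, (L ^ 2 + y ^ 2) * (((K (0 : EspE L hL) : W L) : ℝ → ℝ) y * v y))
        + t * ∫ y, (L ^ 2 + y ^ 2) * (profile (0 : EspE L hL) y * v y) = 0 := by
  obtain ⟨hVs, hVb⟩ := shift_hypsE h s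
  have e1 : linForm L d (fun ξ => V ξ + s) (profile (0 : EspE L hL)) (derE (0 : EspE L hL)) v v₁ =
      EformE hL h.d_meas hVs h.D₁_nonneg h.d_le hVb (0 : EspE L hL) ⟨(v, v₁), hv, h0⟩ := by rw [EformE_apply]
  have e2 : ∫ y, (L ^ 2 + y ^ 2) * (((K (0 : EspE L hL) : W L) : ℝ → ℝ) y * v y) = PdataE hL (K (0 : EspE L hL)) ⟨(v, v₁), hv, h0⟩ := by
    rw [PdataE_apply]
  have e3 : ∫ y, (L ^ 2 + y ^ 2) * (profile (0 : EspE L hL) y * v y) = BcplE hL (0 : EspE L hL) ⟨(v, v₁), hv, h0⟩ := by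
    rw [BcplE_apply]
  rw [e1, e2, e3]
  simp only [map_zero, LinearMap.zero_apply, mul_zero, add_zero, sub_zero, and_self]

/-- **Injectivity of `R⁺_K(σ)` on the even zero-mass class** (`Re σ > −m`). [folklore] -/
theorem injective_resolventEven (hL : 0 < L) (K : EspE L hL →L[ℝ] W L) (h : GardingDataKE L hL d V K D₀ D₁ V₀ c m) {σ : ℂ}
    (hσ : -m < σ.re) : Function.Injective (resolventEven hL K h σ) := by
  refine (injective_iff_map_eq_zero (resolventEven hL K h σ)).2 fun G hG => ?_
  have h0 : resolventKE hL K h σ (G : Wc L) = 0 := by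
    rw [← coe_resolventEven hL K h σ G, hG, Submodule.coe_zero]
  obtain ⟨happ, -, -, hweak⟩ := resolventKE_weak hL K h hσ (G : Wc L)
  set P := pairOpKE hL K h σ hσ (toPair L (G : Wc L)) with hP
  have hι : ιpairE hL P = 0 := by rw [← toPair_ofPair (ιpairE hL P), ← happ, h0, map_zero]
  obtain ⟨hι1, hι2⟩ := ιpairE_fst_snd hL P
  have hPf : P.fst = 0 := eq_zero_of_ιEE_eq_zero hL (by rw [← hι1, hι, WithLp.zero_fst])
  have hPs : P.snd = 0 := eq_zero_of_ιEE_eq_zero hL (by rw [← hι2, hι, WithLp.zero_snd])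
  obtain ⟨hGf, hGs⟩ := toPair_fst_snd (G : Wc L)
  have hre : ∀ v v₁ : ℝ → ℝ, IsCompactTestE v v₁ → ∫ y, v y = 0 →
      ∫ y, (L ^ 2 + y ^ 2) * (((reW L (G : Wc L) : W L) : ℝ → ℝ) y * v y) = 0 := by
    intro v v₁ hv hv0
    have e := (hweak v v₁ hv hv0).1
    rw [hPf, hPs, (lhs_zeroE hL K h σ.re σ.im v v₁ hv hv0).1] at e
    exact e.symm
  have him : ∀ v v₁ : ℝ → ℝ, IsCompactTestE v v₁ → ∫ y, v y = 0 →
      ∫ y, (L ^ 2 + y ^ 2) * (((imW L (G : Wc L) : W L) : ℝ → ℝ) y * v y) = 0 := by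
    intro v v₁ hv hv0
    have e := (hweak v v₁ hv hv0).2
    rw [hPf, hPs, (lhs_zeroE hL K h σ.re σ.im v v₁ hv hv0).2] at e
    exact e.symm
  exact Subtype.ext (eq_zero_of_mem_WcevenZ hL G.2 hre him)

/-! ### §3 The closed operator on the even zero-mass class whose resolvent is `R⁺_K(σ)` -/

/-- **The closed operator behind `R⁺_K`** (Kato VIII-§1.1): `T⁺ := operatorOfResolvent (resolventEven hL K h) σ₀ _`, domain `Ran R⁺_K(σ₀)`,
`T⁺(R⁺_K(σ₀)G) = σ₀R⁺_K(σ₀)G − G`; in the cell's notation `T⁺ = −A⁺_F|_{E⁺₀}`. [folklore] -/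
def generatorEven (hL : 0 < L) (K : EspE L hL →L[ℝ] W L) (h : GardingDataKE L hL d V K D₀ D₁ V₀ c m) (σ₀ : ℂ) (hσ₀ : -m < σ₀.re) :
    WcevenZ hL →ₗ.[ℂ] WcevenZ hL :=
  operatorOfResolvent (resolventEven hL K h) σ₀ (injective_resolventEven hL K h hσ₀)

/-- `T⁺` is a closed operator. [folklore] -/
theorem isClosed_generatorEven (hL : 0 < L) (K : EspE L hL →L[ℝ] W L) (h : GardingDataKE L hL d V K D₀ D₁ V₀ c m) (σ₀ : ℂ)
    (hσ₀ : -m < σ₀.re) : (generatorEven hL K h σ₀ hσ₀).IsClosed :=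
  isClosed_operatorOfResolvent

/-- The domain of `T⁺` is `Ran R⁺_K(σ₀)`. [folklore] -/
theorem generatorEven_domain (hL : 0 < L) (K : EspE L hL →L[ℝ] W L) (h : GardingDataKE L hL d V K D₀ D₁ V₀ c m) (σ₀ : ℂ)
    (hσ₀ : -m < σ₀.re) :
    (generatorEven hL K h σ₀ hσ₀).domain = LinearMap.range (resolventEven hL K h σ₀ : WcevenZ hL →ₗ[ℂ] WcevenZ hL) :=
  operatorOfResolvent_domain

/-- `R⁺_K(σ)G` lies in the domain of `T⁺` for every `σ` in the half-plane. [folklore] -/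
theorem resolventEven_mem_domain (hL : 0 < L) (K : EspE L hL →L[ℝ] W L) (h : GardingDataKE L hL d V K D₀ D₁ V₀ c m) {σ₀ σ : ℂ}
    (hσ₀ : -m < σ₀.re) (hσ : -m < σ.re) (G : WcevenZ hL) : resolventEven hL K h σ G ∈ (generatorEven hL K h σ₀ hσ₀).domain :=
  (isPseudoResolvent_resolventEven hL K h).apply_mem_domain_of_mem hσ₀ hσ G

/-- **`(σ − T⁺) R⁺_K(σ) = 1`** on the even zero-mass class, for every `σ` with `Re σ > −m`. [folklore] -/
theorem generatorEven_resolventEven (hL : 0 < L) (K : EspE L hL →L[ℝ] W L) (h : GardingDataKE L hL d V K D₀ D₁ V₀ c m) {σ₀ σ : ℂ}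
    (hσ₀ : -m < σ₀.re) (hσ : -m < σ.re) (G : WcevenZ hL) :
    generatorEven hL K h σ₀ hσ₀ ⟨resolventEven hL K h σ G, resolventEven_mem_domain hL K h hσ₀ hσ G⟩ =
      σ • resolventEven hL K h σ G - G :=
  (isPseudoResolvent_resolventEven hL K h).apply_resolvent_of_mem hσ₀ hσ G

/-- **`R⁺_K(σ)(σ − T⁺) = 1` on `D(T⁺)`**, for every `σ` with `Re σ > −m`. [folklore] -/
theorem resolventEven_generatorEven (hL : 0 < L) (K : EspE L hL →L[ℝ] W L) (h : GardingDataKE L hL d V K D₀ D₁ V₀ c m) {σ₀ σ : ℂ}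
    (hσ₀ : -m < σ₀.re) (hσ : -m < σ.re) {u : WcevenZ hL} (hu : u ∈ (generatorEven hL K h σ₀ hσ₀).domain) :
    resolventEven hL K h σ (σ • u - generatorEven hL K h σ₀ hσ₀ ⟨u, hu⟩) = u :=
  (isPseudoResolvent_resolventEven hL K h).resolvent_apply_sub hσ₀ hσ hu

/-- **Eigenvalues of `T⁺` read off from the resolvent**: for `σ` in the half-plane and `σ ≠ μ`, `u` is an eigenvector of `T⁺` with
eigenvalue `μ` iff `R⁺_K(σ)u = (σ − μ)⁻¹u`. [folklore] -/
theorem eigen_generatorEven_iff (hL : 0 < L) (K : EspE L hL →L[ℝ] W L) (h : GardingDataKE L hL d V K D₀ D₁ V₀ c m) {σ₀ σ μ : ℂ}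
    (hσ₀ : -m < σ₀.re) (hσ : -m < σ.re) (hσμ : σ ≠ μ) (u : WcevenZ hL) :
    (∃ hu : u ∈ (generatorEven hL K h σ₀ hσ₀).domain, generatorEven hL K h σ₀ hσ₀ ⟨u, hu⟩ = μ • u) ↔
      resolventEven hL K h σ u = (σ - μ)⁻¹ • u :=
  (isPseudoResolvent_resolventEven hL K h).eigen_iff_apply_eq_inv_smul hσ₀ hσ hσμ u

end SheetRResolventEvenClass
end Summit.NavierStokesRegularity.OSWSelfSimilar

end
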